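import Summits.CriticalPhenomena.SAWScalingLimit.Theses.SAWRenewalTightness
import Literature.Probability.RandomPlanarGeometry.BDGS2012Proofs
import Literature.Probability.RandomPlanarGeometry.BDGS2012CountBoundsProofs

/-!
# `AnnularMassDecay` (crux stmt-CriticalPhenomena-4729): load-bearing hypotheses — negative lemmas

Support file for the crux `Summit.CriticalPhenomena.SAWScalingLimit.Theses.SAWRenewalTightness.AnnularMassDecay`
(route SAWRenewalTightness r3), written by the standing disprover (cdisprove).  It does NOT refute the
crux; it proves that three of its hypotheses cannot be dropped and that a fourth is redundant:

* `annMass z r R u N` — the crux's double sum, named (`annularMassDecay_iff : AnnularMassDecay ↔ …`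
  is `Iff.rfl`);
* `annularMassDecay_false_without_startOutside` — dropping `R ≤ dist u z` makes it false (trivial walk at
  `u = z`);
* `annularMassDecay_false_without_innerRadiusOne` — weakening `1 ≤ r` to `0 < r` makes it false (the walk
  `(2,0) → (1,0) → (0,0)` at `R = 2`, `r → 0⁺`): the bound is not scale-free below one lattice spacing;
* `annularMassDecay_false_without_endInside` — dropping the endpoint clause makes it false (one-step walks);
* `annularMassDecay_iff_posR` — `r < R` may be weakened to `0 < R` (for `R ≤ r` the annulus is empty and
  `annMass ≤ c₀ + c₁ x_c ≤ 5`).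

All proofs are elementary (explicit walks + `x_c ∈ (0,1]` + `t ↦ t^θ` continuous/unbounded). [folklore]
-/

namespace Summit.CriticalPhenomena.SAWScalingLimit.Theorems.AnnularMassDecay.Negative

open Literature.Probability.RandomPlanarGeometry Literature.Probability.LatticeModels Filter Topology
open scoped BigOperators Classical
open Summit.CriticalPhenomena.SAWScalingLimit.Theses.SAWRenewalTightness (AnnularMassDecay)

noncomputable section

/-! ### The crux's sum, named -/

/-- The annular-bridge partial sum of the crux: `x_c`-mass of SAWs of length `≤ N` from `u` whose
interior vertices lie in the open annulus `r < |· - z| < R` and whose endpoint lies in `|· - z| ≤ r`.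
[folklore] -/
def annMass (z : ℂ) (r R : ℝ) (u : Site 2) (N : ℕ) : ℝ :=
  ∑ n ∈ Finset.range (N + 1), ∑ _ω ∈ (SAW.Zd.saws 2 n).filter (fun ω =>
    (∀ i, 0 < i → i < n → r < dist (Site.toComplex (u + ω i)) z ∧
      dist (Site.toComplex (u + ω i)) z < R) ∧ dist (Site.toComplex (u + ω n)) z ≤ r),
      SAW.criticalFugacity ^ n

/-- `annMass` is literally the double sum of the crux. -/
theorem annularMassDecay_iff :
    AnnularMassDecay ↔ ∃ θ C : ℝ, 0 < θ ∧ ∀ (z : ℂ) (r R : ℝ), 1 ≤ r → r < R →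
      ∀ u : Site 2, R ≤ dist (Site.toComplex u) z → ∀ N : ℕ, annMass z r R u N ≤ C * (r / R) ^ θ :=
  Iff.rfl

/-! ### Basic facts -/

/-- `0 < x_c` (`x_c = 1/μ`, `μ ≥ 1`). [folklore] -/
theorem criticalFugacity_pos : 0 < SAW.criticalFugacity := by
  have h := SAW.Zd.criticalPoint_pos 2
  rwa [SAW.Zd.criticalPoint_two] at h

/-- `x_c ≤ 1` (`μ ≥ 1`). [folklore] -/
theorem criticalFugacity_le_one : SAW.criticalFugacity ≤ 1 := by
  have h := SAW.Zd.one_le_connectiveConstant 2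
  rw [SAW.Zd.connectiveConstant_two] at h
  unfold SAW.criticalFugacity
  exact inv_le_one_of_one_le₀ h

/-- The annular mass is a sum of nonnegative terms. [folklore] -/
theorem annMass_nonneg (z : ℂ) (r R : ℝ) (u : Site 2) (N : ℕ) : 0 ≤ annMass z r R u N :=
  Finset.sum_nonneg fun n _ => Finset.sum_nonneg fun _ _ => pow_nonneg criticalFugacity_pos.le n

/-- One admissible walk of length `n ≤ N` already contributes `x_c ^ n`. -/
theorem pow_le_annMass {z : ℂ} {r R : ℝ} {u : Site 2} {N n : ℕ} (hn : n ≤ N) {ω : ℕ → Site 2}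
    (hω : ω ∈ SAW.Zd.saws 2 n)
    (hint : ∀ i, 0 < i → i < n → r < dist (Site.toComplex (u + ω i)) z ∧
      dist (Site.toComplex (u + ω i)) z < R)
    (hend : dist (Site.toComplex (u + ω n)) z ≤ r) :
    SAW.criticalFugacity ^ n ≤ annMass z r R u N := by
  unfold annMass
  have hx : 0 ≤ SAW.criticalFugacity := criticalFugacity_pos.le
  calc SAW.criticalFugacity ^ n
      ≤ ∑ _ω ∈ (SAW.Zd.saws 2 n).filter (fun ω =>
          (∀ i, 0 < i → i < n → r < dist (Site.toComplex (u + ω i)) z ∧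
            dist (Site.toComplex (u + ω i)) z < R) ∧ dist (Site.toComplex (u + ω n)) z ≤ r),
          SAW.criticalFugacity ^ n :=
        Finset.single_le_sum (f := fun _ => SAW.criticalFugacity ^ n) (fun _ _ => pow_nonneg hx n)
          (Finset.mem_filter.2 ⟨hω, hint, hend⟩)
    _ ≤ _ := Finset.single_le_sum
          (f := fun m => ∑ _ω ∈ (SAW.Zd.saws 2 m).filter (fun ω =>
            (∀ i, 0 < i → i < m → r < dist (Site.toComplex (u + ω i)) z ∧
              dist (Site.toComplex (u + ω i)) z < R) ∧ dist (Site.toComplex (u + ω m)) z ≤ r),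
            SAW.criticalFugacity ^ m)
          (fun m _ => Finset.sum_nonneg fun _ _ => pow_nonneg hx m)
          (Finset.mem_range.2 (Nat.lt_succ_of_le hn))

/-! ### Concrete sites and walks on the real axis -/

/-- The site `(k, 0)`. -/
def ax (k : ℤ) : Site 2 := ![k, 0]

/-- `(k, 0) ↦ k ∈ ℂ`. [folklore] -/
theorem toComplex_ax (k : ℤ) : Site.toComplex (ax k) = (k : ℂ) := by
  apply Complex.ext <;> simp [Site.toComplex, ax]

/-- `|(k,0)| = |k|`. [folklore] -/
theorem dist_ax_zero (k : ℤ) : dist (Site.toComplex (ax k)) 0 = |(k : ℝ)| := by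
  rw [toComplex_ax, dist_zero_right]
  simp

/-- Addition on the axis. [folklore] -/
theorem ax_add (a b : ℤ) : ax a + ax b = ax (a + b) := by
  funext j; fin_cases j <;> simp [ax]

/-- `(0,0) = 0`. [folklore] -/
theorem ax_zero : ax 0 = 0 := by
  funext j; fin_cases j <;> simp [ax]

/-- The origin embeds to `0`. [folklore] -/
theorem toComplex_zero : Site.toComplex 0 = 0 := by
  apply Complex.ext <;> simp [Site.toComplex]

/-- The trivial walk. -/
theorem const_zero_mem_saws : (fun _ => (0 : Site 2)) ∈ SAW.Zd.saws 2 0 := by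
  rw [SAW.Zd.mem_saws]
  exact ⟨rfl, fun _ _ => rfl, fun i hi => absurd hi (Nat.not_lt_zero i),
    fun i hi j hj _ => (Nat.le_zero.1 hi).trans (Nat.le_zero.1 hj).symm⟩

/-- The one-step walk `0 → e₀`, frozen afterwards. -/
def ω₁ : ℕ → Site 2
  | 0 => ax 0
  | _ => ax 1

/-- `ω₁` is a one-step SAW from `0`. [folklore] -/
theorem ω₁_mem : ω₁ ∈ SAW.Zd.saws 2 1 := by
  rw [SAW.Zd.mem_saws]
  refine ⟨ax_zero, ?_, ?_, ?_⟩
  · intro i hi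
    obtain ⟨k, rfl⟩ := Nat.exists_eq_add_of_le' hi
    rfl
  · intro i hi
    interval_cases i
    show (zdGraph 2).Adj (ax 0) (ax 1)
    rw [zdGraph_adj_iff]; exact ⟨0, Or.inl (by funext j; fin_cases j <;> simp [ax])⟩
  · intro i hi j hj h
    simp only [Set.mem_setOf_eq] at hi hj
    have key : ∀ i ≤ 1, ∀ j ≤ 1, ω₁ i 0 = ω₁ j 0 → i = j := by decide
    exact key i hi j hj (by rw [h])

/-- The two-step walk `0 → -e₀ → -2e₀`, frozen afterwards. -/
def ω₂ : ℕ → Site 2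
  | 0 => ax 0
  | 1 => ax (-1)
  | _ => ax (-2)

/-- `ω₂` is a two-step SAW from `0`. [folklore] -/
theorem ω₂_mem : ω₂ ∈ SAW.Zd.saws 2 2 := by
  rw [SAW.Zd.mem_saws]
  refine ⟨ax_zero, ?_, ?_, ?_⟩
  · intro i hi
    obtain ⟨k, rfl⟩ := Nat.exists_eq_add_of_le' hi
    rfl
  · intro i hi
    interval_cases i
    · show (zdGraph 2).Adj (ax 0) (ax (-1))
      rw [zdGraph_adj_iff]; exact ⟨0, Or.inr (by funext j; fin_cases j <;> simp [ax])⟩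
    · show (zdGraph 2).Adj (ax (-1)) (ax (-2))
      rw [zdGraph_adj_iff]; exact ⟨0, Or.inr (by funext j; fin_cases j <;> simp [ax])⟩
  · intro i hi j hj h
    simp only [Set.mem_setOf_eq] at hi hj
    have key : ∀ i ≤ 2, ∀ j ≤ 2, ω₂ i 0 = ω₂ j 0 → i = j := by decide
    exact key i hi j hj (by rw [h])

/-- `C (1/R)^θ → 0` as `R → ∞` (`θ > 0`). -/
theorem tendsto_const_mul_one_div_rpow {θ : ℝ} (hθ : 0 < θ) (C : ℝ) :
    Tendsto (fun R : ℝ => C * (1 / R) ^ θ) atTop (𝓝 0) := by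
  have h := ((tendsto_rpow_atTop hθ).inv_tendsto_atTop).const_mul C
  rw [mul_zero] at h
  refine h.congr' ?_
  filter_upwards [eventually_ge_atTop 0] with R hR
  simp [one_div, Real.inv_rpow hR]

/-! ### §A Load-bearing hypotheses -/

/-- Any proof of the crux must use `R ≤ dist u z`: without it the trivial walk at `u = z = 0`
is an "annular bridge" of mass `1` for every `R`, while `C (1/R)^θ → 0`. -/
theorem annularMassDecay_false_without_startOutside :
    ¬ ∃ θ C : ℝ, 0 < θ ∧ ∀ (z : ℂ) (r R : ℝ), 1 ≤ r → r < R → ∀ u : Site 2, ∀ N : ℕ,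
      annMass z r R u N ≤ C * (r / R) ^ θ := by
  rintro ⟨θ, C, hθ, h⟩
  have h1 : ∀ R : ℝ, 1 < R → (1 : ℝ) ≤ C * (1 / R) ^ θ := by
    intro R hR
    refine le_trans ?_ (h 0 1 R le_rfl hR 0 0)
    have := pow_le_annMass (z := 0) (r := 1) (R := R) (u := 0) (N := 0) (n := 0) le_rfl
      const_zero_mem_saws (fun i _ hin => absurd hin (Nat.not_lt_zero i))
      (by rw [add_zero, toComplex_zero, dist_self]; exact zero_le_one)
    simpa using this
  obtain ⟨R, hR1, hR2⟩ := ((eventually_gt_atTop 1).and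
    ((tendsto_const_mul_one_div_rpow hθ C).eventually (gt_mem_nhds one_pos))).exists
  exact lt_irrefl _ ((h1 R hR1).trans_lt hR2)

/-- Any proof of the crux must use `1 ≤ r`: for `0 < r < 1`, `z = 0`, `R = 2`, `u = (2,0)` the walk
`(2,0) → (1,0) → (0,0)` is an annular bridge of mass `x_c²`, but `C (r/2)^θ → 0` as `r → 0⁺`. -/
theorem annularMassDecay_false_without_innerRadiusOne :
    ¬ ∃ θ C : ℝ, 0 < θ ∧ ∀ (z : ℂ) (r R : ℝ), 0 < r → r < R → ∀ u : Site 2,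
      R ≤ dist (Site.toComplex u) z → ∀ N : ℕ, annMass z r R u N ≤ C * (r / R) ^ θ := by
  rintro ⟨θ, C, hθ, h⟩
  have h1 : ∀ r : ℝ, 0 < r → r < 1 → SAW.criticalFugacity ^ 2 ≤ C * (r / 2) ^ θ := by
    intro r hr0 hr1
    have hu : (2 : ℝ) ≤ dist (Site.toComplex (ax 2)) 0 := by rw [dist_ax_zero]; norm_num
    refine le_trans ?_ (h 0 r 2 hr0 (by linarith) (ax 2) hu 2)
    refine pow_le_annMass le_rfl ω₂_mem ?_ ?_
    · intro i hi0 hi2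
      obtain rfl : i = 1 := by omega
      show r < dist (Site.toComplex (ax 2 + ax (-1))) 0 ∧ dist (Site.toComplex (ax 2 + ax (-1))) 0 < 2
      rw [ax_add, dist_ax_zero]; norm_num; exact hr1
    · show dist (Site.toComplex (ax 2 + ax (-2))) 0 ≤ r
      rw [ax_add, dist_ax_zero]; norm_num; exact hr0.le
  have ht : Tendsto (fun r : ℝ => C * (r / 2) ^ θ) (𝓝[>] 0) (𝓝 0) := by
    have hc : Continuous fun r : ℝ => C * (r / 2) ^ θ :=
      continuous_const.mul ((continuous_id.div_const 2).rpow_const fun _ => Or.inr hθ.le)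
    have := hc.tendsto 0
    simp only [zero_div, Real.zero_rpow hθ.ne', mul_zero] at this
    exact tendsto_nhdsWithin_of_tendsto_nhds this
  have hx2 : 0 < SAW.criticalFugacity ^ 2 := pow_pos criticalFugacity_pos 2
  have e1 : ∀ᶠ r in 𝓝[>] (0 : ℝ), 0 < r := self_mem_nhdsWithin
  have e2 : ∀ᶠ r in 𝓝[>] (0 : ℝ), r < 1 := mem_nhdsWithin_of_mem_nhds (Iio_mem_nhds one_pos)
  obtain ⟨r, hr0, hr1, hr2⟩ := (e1.and (e2.and (ht.eventually (gt_mem_nhds hx2)))).exists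
  exact lt_irrefl _ ((h1 r hr0 hr1).trans_lt hr2)

/-- The crux's sum with the endpoint clause `dist (u + ω n) z ≤ r` DROPPED. -/
def annMassNoEnd (z : ℂ) (r R : ℝ) (u : Site 2) (N : ℕ) : ℝ :=
  ∑ n ∈ Finset.range (N + 1), ∑ _ω ∈ (SAW.Zd.saws 2 n).filter (fun ω =>
    ∀ i, 0 < i → i < n → r < dist (Site.toComplex (u + ω i)) z ∧
      dist (Site.toComplex (u + ω i)) z < R), SAW.criticalFugacity ^ n

/-- One admissible walk of length `n ≤ N` contributes `x_c ^ n` (no-endpoint-clause sum). [folklore] -/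
theorem pow_le_annMassNoEnd {z : ℂ} {r R : ℝ} {u : Site 2} {N n : ℕ} (hn : n ≤ N)
    {ω : ℕ → Site 2} (hω : ω ∈ SAW.Zd.saws 2 n)
    (hint : ∀ i, 0 < i → i < n → r < dist (Site.toComplex (u + ω i)) z ∧
      dist (Site.toComplex (u + ω i)) z < R) :
    SAW.criticalFugacity ^ n ≤ annMassNoEnd z r R u N := by
  unfold annMassNoEnd
  have hx : 0 ≤ SAW.criticalFugacity := criticalFugacity_pos.le
  calc SAW.criticalFugacity ^ n
      ≤ ∑ _ω ∈ (SAW.Zd.saws 2 n).filter (fun ω =>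
          ∀ i, 0 < i → i < n → r < dist (Site.toComplex (u + ω i)) z ∧
            dist (Site.toComplex (u + ω i)) z < R), SAW.criticalFugacity ^ n :=
        Finset.single_le_sum (f := fun _ => SAW.criticalFugacity ^ n) (fun _ _ => pow_nonneg hx n)
          (Finset.mem_filter.2 ⟨hω, hint⟩)
    _ ≤ _ := Finset.single_le_sum
          (f := fun m => ∑ _ω ∈ (SAW.Zd.saws 2 m).filter (fun ω =>
            ∀ i, 0 < i → i < m → r < dist (Site.toComplex (u + ω i)) z ∧
              dist (Site.toComplex (u + ω i)) z < R), SAW.criticalFugacity ^ m)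
          (fun m _ => Finset.sum_nonneg fun _ _ => pow_nonneg hx m)
          (Finset.mem_range.2 (Nat.lt_succ_of_le hn))

/-- Any proof of the crux must use the endpoint clause: without it the one-step walk from
`u = (m, 0)` (`z = 0`, `r = 1`, `R = m`) has mass `x_c` for every `m`, while `C (1/m)^θ → 0`. -/
theorem annularMassDecay_false_without_endInside :
    ¬ ∃ θ C : ℝ, 0 < θ ∧ ∀ (z : ℂ) (r R : ℝ), 1 ≤ r → r < R → ∀ u : Site 2,
      R ≤ dist (Site.toComplex u) z → ∀ N : ℕ, annMassNoEnd z r R u N ≤ C * (r / R) ^ θ := by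
  rintro ⟨θ, C, hθ, h⟩
  obtain ⟨a, ha⟩ := Filter.eventually_atTop.1
    ((tendsto_const_mul_one_div_rpow hθ C).eventually (gt_mem_nhds criticalFugacity_pos))
  set m : ℕ := max ⌈a⌉₊ 2 with hm
  have hma : a ≤ (m : ℝ) := (Nat.le_ceil a).trans (by exact_mod_cast le_max_left _ _)
  have hm2 : (2 : ℝ) ≤ (m : ℝ) := by exact_mod_cast le_max_right _ _
  have hu : (m : ℝ) ≤ dist (Site.toComplex (ax m)) 0 := by
    rw [dist_ax_zero]; simp
  have h1 : SAW.criticalFugacity ≤ C * (1 / (m : ℝ)) ^ θ := by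
    refine le_trans ?_ (h 0 1 m le_rfl (by linarith) (ax m) hu 1)
    have := pow_le_annMassNoEnd (z := 0) (r := 1) (R := (m : ℝ)) (u := ax m) (N := 1) (n := 1)
      le_rfl ω₁_mem (fun i hi0 hi1 => absurd hi1 (by omega))
    simpa using this
  exact lt_irrefl _ (h1.trans_lt (ha m hma))

/-! ### §A' The hypothesis `r < R` is redundant (replace by `0 < R`) -/

/-- For `R ≤ r` the open annulus is empty: only walks of length `≤ 1` are counted, so
`annMass ≤ c₀ + c₁ x_c ≤ 1 + 4 = 5`. -/
theorem annMass_le_five_of_le {r R : ℝ} (hRr : R ≤ r) (z : ℂ) (u : Site 2) (N : ℕ) :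
    annMass z r R u N ≤ 5 := by
  classical
  unfold annMass
  have hx : 0 ≤ SAW.criticalFugacity := criticalFugacity_pos.le
  -- the summand vanishes for `n ≥ 2`
  set f : ℕ → ℝ := fun n => ∑ _ω ∈ (SAW.Zd.saws 2 n).filter (fun ω =>
    (∀ i, 0 < i → i < n → r < dist (Site.toComplex (u + ω i)) z ∧
      dist (Site.toComplex (u + ω i)) z < R) ∧ dist (Site.toComplex (u + ω n)) z ≤ r),
      SAW.criticalFugacity ^ n with hf
  have hf0 : ∀ n, 2 ≤ n → f n = 0 := by
    intro n hn
    rw [hf]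
    refine Finset.sum_eq_zero fun ω hω => ?_
    exfalso
    obtain ⟨-, hint, -⟩ := Finset.mem_filter.1 hω
    have := hint 1 one_pos (by omega)
    linarith [this.1, this.2]
  have hfle : ∀ n, f n ≤ (SAW.Zd.count 2 n : ℝ) := by
    intro n
    rw [hf]
    dsimp only
    rw [Finset.sum_const, nsmul_eq_mul]
    calc _ ≤ ((SAW.Zd.saws 2 n).card : ℝ) * SAW.criticalFugacity ^ n :=
          mul_le_mul_of_nonneg_right (by exact_mod_cast Finset.card_filter_le _ _) (pow_nonneg hx n)
      _ ≤ (SAW.Zd.saws 2 n).card * 1 :=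
          mul_le_mul_of_nonneg_left (pow_le_one₀ hx criticalFugacity_le_one) (Nat.cast_nonneg _)
      _ = (SAW.Zd.count 2 n : ℝ) := by rw [mul_one, SAW.Zd.card_saws]
  have hfnn : ∀ n, 0 ≤ f n := fun n => by
    rw [hf]; exact Finset.sum_nonneg fun _ _ => pow_nonneg hx n
  calc ∑ n ∈ Finset.range (N + 1), f n
      = ∑ n ∈ (Finset.range (N + 1)).filter (· < 2), f n := by
        refine (Finset.sum_subset (Finset.filter_subset _ _) fun n hn hn' => hf0 n ?_).symm
        by_contra hlt
        exact hn' (Finset.mem_filter.2 ⟨hn, by omega⟩)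
    _ ≤ ∑ n ∈ Finset.range 2, f n := by
        refine Finset.sum_le_sum_of_subset_of_nonneg (fun n hn => ?_) fun n _ _ => hfnn n
        exact Finset.mem_range.2 (Finset.mem_filter.1 hn).2
    _ = f 0 + f 1 := by simp [Finset.sum_range_succ]
    _ ≤ (SAW.Zd.count 2 0 : ℝ) + (SAW.Zd.count 2 1 : ℝ) := add_le_add (hfle 0) (hfle 1)
    _ ≤ 1 + 4 := by
        gcongr
        · exact_mod_cast (SAW.Zd.count_zero 2).le
        · exact_mod_cast (SAW.Zd.count_one_le 2).trans (by norm_num)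
    _ = 5 := by norm_num

/-- `r < R` may be replaced by `0 < R`: the two forms are equivalent. -/
theorem annularMassDecay_iff_posR :
    AnnularMassDecay ↔ ∃ θ C : ℝ, 0 < θ ∧ ∀ (z : ℂ) (r R : ℝ), 1 ≤ r → 0 < R → ∀ u : Site 2,
      R ≤ dist (Site.toComplex u) z → ∀ N : ℕ, annMass z r R u N ≤ C * (r / R) ^ θ := by
  rw [annularMassDecay_iff]
  constructor
  · rintro ⟨θ, C, hθ, h⟩
    refine ⟨θ, max C 5, hθ, fun z r R hr hR u hu N => ?_⟩
    have hrR0 : 0 ≤ (r / R) ^ θ := Real.rpow_nonneg (div_nonneg (by linarith) hR.le) θ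
    rcases lt_or_ge r R with hlt | hge
    · exact (h z r R hr hlt u hu N).trans (mul_le_mul_of_nonneg_right (le_max_left _ _) hrR0)
    · have h1 : (1 : ℝ) ≤ (r / R) ^ θ := Real.one_le_rpow ((one_le_div hR).2 hge) hθ.le
      calc annMass z r R u N ≤ 5 := annMass_le_five_of_le hge z u N
        _ ≤ max C 5 * (r / R) ^ θ := by
          have := le_max_right C 5
          nlinarith
  · rintro ⟨θ, C, hθ, h⟩
    exact ⟨θ, C, hθ, fun z r R hr hrR u hu N => h z r R hr (by linarith) u hu N⟩

end

end Summit.CriticalPhenomena.SAWScalingLimit.Theorems.AnnularMassDecay.Negative
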